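import Summits.BirchSwinnertonDyer.Rank1Residual.GaloisImage.KolyvaginStalkKappa
import HarnessLib

/-!
# The Kolyvagin system `κ^ε`: the finite–singular relations (a row swap in a volume form),
# non-vanishing at every core vertex, and the existence half of the structure theorem at `m = 1`
# (cell `b2b-bsdres`, team n1011, ROUTE-1 item R1-56 "S24(1) @ m = 1 in the kernel", row T-R1-56-S,
# FILE D4 = K4 EXISTENCE, end)

HONEST FRAMING (verbatim for the cell): research route; prove what is provable now; no claim beyond
stated classes; nothing booked; no mark / label moved.  TOOL theorems about Kolyvagin systems of a
finite Galois module at the residual level `m = 1`; theorems only: no definition, no named fact, no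
conjecture node.  Setting = p11's R1-16 files + FILES A / C / D1–D3 of the row.

## What (Mazur–Rubin, JTNB 28 (2016) Prop. 8.3, Lemma 8.2, Thm. 8.4 at rank one over a field)

For the classes `κ_n = (−1)^{#n} · cross_{W(n ∪ N₀)} (vol (n ∪ N₀)) φ_n` of `KolyvaginStalkKappa.lean`:
* `cross_eq_cross_of_subset`: the cross product may be read at any bigger level (compatibility of
  the volume system `contract_vol_vol` + `cross_contract`);
* `kappa_fs_rel`: **`loc^s_𝔮 κ_{n𝔮} = φ^{fs}_𝔮 (loc_𝔮 κ_n)`** — at the common level `n𝔮 ∪ N₀` the two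
  slot families differ by exchanging `t_𝔮` and `f_𝔮` between the free slot and the slot `𝔮`: the
  SWAP identity `VolumeForm.apply_cross_update`; the sign `(−1)^{#n}` absorbs the `−1`
  (Mazur–Rubin Prop. 8.3 (i), `(−1)^{ν(𝔫)}`);
* `isKolyvaginSystem_kappa`: **`κ ∈ KS₁(M, 𝓕, 𝒫)`**;
* `kappa_ne_zero_of_natCard_eq`: **`κ_n ≠ 0` at every core vertex** (`#H¹_{𝓕(n)} = p`): the
  `φ_n(𝔮)|_{W}` cut the LINE `H¹_{𝓕(n)}` out of `W(n ∪ N₀)`, so they are independent and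
  `VolumeForm.cross_ne_zero` applies (Mazur–Rubin Lemma 8.2);
* **`exists_isKolyvaginSystem_ne_zero_of_core`** — the instance-free END statement of K4: under
  p11's R1-16 binders with `χ(𝓕) = 1`, `#H¹(K_𝔮, M) = p²` and `H¹_ur ⊓ H¹_tr = 0` at `𝒫`, the
  one-class dual prime choice and `#H¹_{𝓕(n)} = p` at core vertices (p11 G1.2), THERE IS a
  Kolyvagin system non-zero at every core vertex (Rubin PCMI Thm. 2.8.8 / Cor. 2.8.9 (2), the
  surjectivity half, at `m = 1`).  With p11's injectivity (T-R1-56-G G5.2) this is [S24]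
  Thm. 4.4 (1) at `m = 1` (FILE E of the row).

References: B. Mazur, K. Rubin, JTNB 28 (2016) 145–183 (arXiv:1312.4052) Def. 8.1, Lemma 8.2,
Prop. 8.3, Thm. 8.4 (read 2026-08-21, held); K. Rubin, PCMI 18 (2011) Def. 2.2.1, Thm. 2.8.8,
Cor. 2.8.9 (held).
-/

noncomputable section

open scoped Classical NumberField ContRepresentation
open Function NumberField IsDedekindDomain
open Literature.NumberTheory.GaloisRepresentations Literature.NumberTheory.GaloisRepresentations.DiscreteGaloisModule
  Literature.NumberTheory.GaloisCohomology
open Summit.BirchSwinnertonDyer.Rank1Residual.GaloisImage.CoreRankZero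
open Summit.BirchSwinnertonDyer.Rank1Residual.GaloisImage.VolumeForm

universe u

namespace Summit.BirchSwinnertonDyer.Rank1Residual.GaloisImage.CoreRankOne.Stalk

variable {K : Type u} [Field K] [NumberField K]
variable {M : Type u} [AddCommGroup M] [TopologicalSpace M] [DiscreteTopology M] [Finite M]
variable {ρ : DiscreteGaloisModule K M} (p : ℕ) [Fact p.Prime] [Module (ZMod p) (galoisCohomology ρ 1)]

section Main

variable {S : Finset (Place K)} {inv : LocalInvariants K p} {𝓕 : SelmerStructure ρ} [Finite 𝓕.selmerGroup]
  {D : KolyvaginDatum ρ} {N₀ : Finset (HeightOneSpectrum (𝓞 K))}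
  {ε₀ : (Module.Dual (ZMod p) (galoisCohomology ρ 1)) [⋀^Option ↥N₀]→ₗ[ZMod p] ZMod p}

/-! ## §4. Moving to a bigger level, and the finite–singular relation -/

/-- The cross product defining `κ_n` may be computed at any bigger core-like level `N′ ⊇ n ∪ N₀`
(compatibility of the volume system + `cross_contract` + `extend_phiFamily`). [folklore] -/
theorem cross_eq_cross_of_subset (hperf : inv.IsPerfect) (hsum : inv.SumLocalTermEqZero)
    (hcompl : inv.SelmerComplement) (hM : ∀ m : M, p • m = 0)
    (hS : ∀ v : HeightOneSpectrum (𝓞 K), (Sum.inr v : Place K) ∉ S →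
      ((p : ℕ) : 𝓞 K) ∉ v.asIdeal ∧ GaloisRep.IsUnramifiedAt v ρ)
    (h𝓕 : 𝓕.IsUnramifiedOutside S) (hfind : Finite (inv.dualSelmerStructure ρ 𝓕).selmerGroup)
    (hχ : LocalInvariants.HasCoreRank inv 𝓕 p 1)
    (hPS : ∀ q ∈ D.primes, (Sum.inr q : Place K) ∉ S)
    (hU : ∀ q ∈ D.primes, Nat.card (unramifiedSubgroup (GaloisRep.toLocal q ρ) 1) = p)
    (hH1 : ∀ q ∈ D.primes, Nat.card (galoisCohomology (GaloisRep.toLocal q ρ) 1) = p ^ 2)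
    (hN₀ : D.IsLevel N₀) (hcore₀ : (inv.dualSelmerStructure ρ (𝓕.relaxedAt N₀)).selmerGroup = ⊥)
    (hε₀ : ε₀ ∈ volOn (Option ↥N₀) (Wsub p 𝓕 N₀))
    {n n' : Finset (HeightOneSpectrum (𝓞 K))} (hn : D.IsLevel n) (hn' : D.IsLevel n') (hnn' : n ⊆ n') :
    ((cross (Wsub p 𝓕 (n ∪ N₀)) (vol p 𝓕 N₀ ε₀ (n ∪ N₀)) (phiFamily p D n (n ∪ N₀)) :
        Wsub p 𝓕 (n ∪ N₀)) : galoisCohomology ρ 1) =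
      ((cross (Wsub p 𝓕 (n' ∪ N₀)) (vol p 𝓕 N₀ ε₀ (n' ∪ N₀)) (phiFamily p D n (n' ∪ N₀)) :
        Wsub p 𝓕 (n' ∪ N₀)) : galoisCohomology ρ 1) := by
  have hfin : Finite 𝓕.selmerGroup := inferInstance
  have hSQ := hSQ_of p hU hH1
  have hW₀ := natCard_selmerGroup_relaxedAt_eq_pow_mul hperf hsum hcompl hM hS h𝓕 hfin hfind hχ hPS hU hH1 hN₀
  rw [hcore₀, AddSubgroup.card_bot, mul_one] at hW₀
  have hW := natCard_relaxedAt_union p hperf hsum hcompl hM hS h𝓕 hfin hfind hχ hPS hU hH1 hN₀ hcore₀ hn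
  have hW' := natCard_relaxedAt_union p hperf hsum hcompl hM hS h𝓕 hfin hfind hχ hPS hU hH1 hN₀ hcore₀ hn'
  have hNN' : n ∪ N₀ ⊆ n' ∪ N₀ := Finset.union_subset_union hnn' subset_rfl
  have hvol := contract_vol_vol p h𝓕 hfin hPS hSQ hε₀ hW₀ Finset.subset_union_right hNN'
    (isLevel_union hn hN₀) (isLevel_union hn' hN₀) hW hW'
  have hv' := (vol_mem_volOn_and_contract_vol p h𝓕 hfin hPS hSQ hε₀ hW₀ Finset.subset_union_right
      (isLevel_union hn' hN₀) hW').1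
  rw [← hvol, cross_contract hv' (levelIncl_injective hNN') (tFamily ρ p (n' ∪ N₀))
      (contract_mem_volOn hv' _ _ (mem_Wsub_of_frozen p h𝓕 hPS hSQ hNN' (isLevel_union hn' hN₀))),
    extend_phiFamily p Finset.subset_union_left hNN']

/-- **The finite–singular relation `loc^s_𝔮 κ_{n𝔮} = φ^{fs}_𝔮 (loc_𝔮 κ_n)`** for a level `n` and a
Kolyvagin prime `𝔮 ∉ n`: read through the common trivialisation `singularTriv`, both sides are values
of the volume form at `n𝔮 ∪ N₀` on slot families that differ by exchanging `t_𝔮` and `f_𝔮` between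
the free slot and the slot `𝔮` — the SWAP identity `apply_cross_update`; the sign `(−1)^{#n}` of
`κ_n` absorbs the resulting `−1` (Mazur–Rubin Prop. 8.3 (i)). [folklore] -/
theorem kappa_fs_rel (hperf : inv.IsPerfect) (hsum : inv.SumLocalTermEqZero)
    (hcompl : inv.SelmerComplement) (hM : ∀ m : M, p • m = 0)
    (hS : ∀ v : HeightOneSpectrum (𝓞 K), (Sum.inr v : Place K) ∉ S →
      ((p : ℕ) : 𝓞 K) ∉ v.asIdeal ∧ GaloisRep.IsUnramifiedAt v ρ)
    (h𝓕 : 𝓕.IsUnramifiedOutside S) (hfind : Finite (inv.dualSelmerStructure ρ 𝓕).selmerGroup)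
    (hχ : LocalInvariants.HasCoreRank inv 𝓕 p 1)
    (hPS : ∀ q ∈ D.primes, (Sum.inr q : Place K) ∉ S) (hadm : D.IsAdmissible)
    (hU : ∀ q ∈ D.primes, Nat.card (unramifiedSubgroup (GaloisRep.toLocal q ρ) 1) = p)
    (hc : ∀ q ∈ D.primes, IsCompl (unramifiedSubgroup (GaloisRep.toLocal q ρ) 1)
      (D.transverse (Sum.inr q) : AddSubgroup (galoisCohomology (GaloisRep.toLocal q ρ) 1)))
    (hH1 : ∀ q ∈ D.primes, Nat.card (galoisCohomology (GaloisRep.toLocal q ρ) 1) = p ^ 2)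
    (hN₀ : D.IsLevel N₀) (hcore₀ : (inv.dualSelmerStructure ρ (𝓕.relaxedAt N₀)).selmerGroup = ⊥)
    (hε₀ : ε₀ ∈ volOn (Option ↥N₀) (Wsub p 𝓕 N₀))
    {n : Finset (HeightOneSpectrum (𝓞 K))} (hn : D.IsLevel n) {q : HeightOneSpectrum (𝓞 K)}
    (hq : q ∈ D.primes) (hqn : q ∉ n) :
    KolyvaginDatum.singularLocalization ρ q (kappa p 𝓕 D N₀ ε₀ (insert q n)) =
      D.fsLocalization q (kappa p 𝓕 D N₀ ε₀ n) := by
  have hfin : Finite 𝓕.selmerGroup := inferInstance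
  have hSQ := hSQ_of p hU hH1
  have hnq : D.IsLevel (insert q n) := hn.insert hq
  -- `κ_n` is unramified at `𝔮`
  have hκn : kappa p 𝓕 D N₀ ε₀ n ∈ (D.atLevel 𝓕 n).selmerGroup :=
    kappa_mem_selmerGroup p hperf hsum hcompl hM hS h𝓕 hfind hχ hPS hadm hU hc hH1 hN₀ hcore₀ hε₀ hn
  have hunr : galoisCohomology.localization ρ (Sum.inr q) 1 (kappa p 𝓕 D N₀ ε₀ n) ∈
      unramifiedSubgroup (GaloisRep.toLocal q ρ) 1 := by
    have := (SelmerStructure.mem_selmerGroup_iff _ _).mp hκn (Sum.inr q)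
    rwa [Level.atLevel_inr_of_not_mem D 𝓕 hqn, h𝓕.2 q (hPS q hq)] at this
  -- it suffices to compare after the (injective) trivialisation: `t_𝔮 κ_{n𝔮} = f_𝔮 κ_n`
  apply singularTriv_injective ρ p (hSQ q hq)
  rw [← fHom_apply_of_mem_unramified p D (hc q hq) hunr, ← tHom_apply]
  -- both classes at the common level `N' = n𝔮 ∪ N₀`
  have hq' : q ∈ insert q n ∪ N₀ := Finset.mem_union_left _ (Finset.mem_insert_self q n)
  have hW' := natCard_relaxedAt_union p hperf hsum hcompl hM hS h𝓕 hfin hfind hχ hPS hU hH1 hN₀ hcore₀ hnq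
  have hW₀ := natCard_selmerGroup_relaxedAt_eq_pow_mul hperf hsum hcompl hM hS h𝓕 hfin hfind hχ hPS hU hH1 hN₀
  rw [hcore₀, AddSubgroup.card_bot, mul_one] at hW₀
  have hv' := (vol_mem_volOn_and_contract_vol p h𝓕 hfin hPS hSQ hε₀ hW₀ Finset.subset_union_right
      (isLevel_union hnq hN₀) hW').1
  rw [kappa_of_isLevel p hnq, kappa_of_isLevel p hn,
    cross_eq_cross_of_subset p hperf hsum hcompl hM hS h𝓕 hfind hχ hPS hU hH1 hN₀ hcore₀ hε₀ hn hnq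
      (Finset.subset_insert q n),
    phiFamily_insert p hq', map_zsmul, map_zsmul, Finset.card_insert_of_notMem hqn]
  -- the swap identity
  have hswap := apply_cross_update hv' (phiFamily p D n (insert q n ∪ N₀)) ⟨q, hq'⟩ (fFun p D q)
  rw [phiFamily_apply_of_not_mem p (show (⟨q, hq'⟩ : ↥(insert q n ∪ N₀)).1 ∉ n from hqn)] at hswap
  rw [tFun_apply, fFun_apply] at hswap
  rw [hswap, pow_succ, smul_neg, mul_neg_one, neg_smul, neg_neg]

/-- **`κ ∈ KS₁(M, 𝓕, 𝒫)`**: the classes `κ_n` form a Kolyvagin system. [folklore] -/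
theorem isKolyvaginSystem_kappa (hperf : inv.IsPerfect) (hsum : inv.SumLocalTermEqZero)
    (hcompl : inv.SelmerComplement) (hM : ∀ m : M, p • m = 0)
    (hS : ∀ v : HeightOneSpectrum (𝓞 K), (Sum.inr v : Place K) ∉ S →
      ((p : ℕ) : 𝓞 K) ∉ v.asIdeal ∧ GaloisRep.IsUnramifiedAt v ρ)
    (h𝓕 : 𝓕.IsUnramifiedOutside S) (hfind : Finite (inv.dualSelmerStructure ρ 𝓕).selmerGroup)
    (hχ : LocalInvariants.HasCoreRank inv 𝓕 p 1)
    (hPS : ∀ q ∈ D.primes, (Sum.inr q : Place K) ∉ S) (hadm : D.IsAdmissible)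
    (hU : ∀ q ∈ D.primes, Nat.card (unramifiedSubgroup (GaloisRep.toLocal q ρ) 1) = p)
    (hc : ∀ q ∈ D.primes, IsCompl (unramifiedSubgroup (GaloisRep.toLocal q ρ) 1)
      (D.transverse (Sum.inr q) : AddSubgroup (galoisCohomology (GaloisRep.toLocal q ρ) 1)))
    (hH1 : ∀ q ∈ D.primes, Nat.card (galoisCohomology (GaloisRep.toLocal q ρ) 1) = p ^ 2)
    (hN₀ : D.IsLevel N₀) (hcore₀ : (inv.dualSelmerStructure ρ (𝓕.relaxedAt N₀)).selmerGroup = ⊥)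
    (hε₀ : ε₀ ∈ volOn (Option ↥N₀) (Wsub p 𝓕 N₀)) :
    D.IsKolyvaginSystem 𝓕 (kappa p 𝓕 D N₀ ε₀) where
  eq_zero_of_not_isLevel _ hn := kappa_of_not_isLevel p hn
  mem_selmerGroup _ hn :=
    kappa_mem_selmerGroup p hperf hsum hcompl hM hS h𝓕 hfind hχ hPS hadm hU hc hH1 hN₀ hcore₀ hε₀ hn
  fs_rel _ hn _ hq hqn :=
    kappa_fs_rel p hperf hsum hcompl hM hS h𝓕 hfind hχ hPS hadm hU hc hH1 hN₀ hcore₀ hε₀ hn hq hqn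

/-! ## §5. `κ_n ≠ 0` at every core vertex -/

/-- **`κ_n ≠ 0` at a core vertex** (`#H¹_{𝓕(n)}(K, M) = p`): the slot functionals `φ_n(𝔮)|_{W(n ∪ N₀)}`
cut the line `H¹_{𝓕(n)}` out of `W(n ∪ N₀)` (of dimension `#(n ∪ N₀) + 1`), hence are independent,
and the cross product of a non-zero volume form with independent functionals is non-zero
(`cross_ne_zero`; Mazur–Rubin Lemma 8.2 at rank one). [folklore] -/
theorem kappa_ne_zero_of_natCard_eq (hperf : inv.IsPerfect) (hsum : inv.SumLocalTermEqZero)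
    (hcompl : inv.SelmerComplement) (hM : ∀ m : M, p • m = 0)
    (hS : ∀ v : HeightOneSpectrum (𝓞 K), (Sum.inr v : Place K) ∉ S →
      ((p : ℕ) : 𝓞 K) ∉ v.asIdeal ∧ GaloisRep.IsUnramifiedAt v ρ)
    (h𝓕 : 𝓕.IsUnramifiedOutside S) (hfind : Finite (inv.dualSelmerStructure ρ 𝓕).selmerGroup)
    (hχ : LocalInvariants.HasCoreRank inv 𝓕 p 1)
    (hPS : ∀ q ∈ D.primes, (Sum.inr q : Place K) ∉ S) (hadm : D.IsAdmissible)
    (hU : ∀ q ∈ D.primes, Nat.card (unramifiedSubgroup (GaloisRep.toLocal q ρ) 1) = p)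
    (hc : ∀ q ∈ D.primes, IsCompl (unramifiedSubgroup (GaloisRep.toLocal q ρ) 1)
      (D.transverse (Sum.inr q) : AddSubgroup (galoisCohomology (GaloisRep.toLocal q ρ) 1)))
    (hH1 : ∀ q ∈ D.primes, Nat.card (galoisCohomology (GaloisRep.toLocal q ρ) 1) = p ^ 2)
    (hN₀ : D.IsLevel N₀) (hcore₀ : (inv.dualSelmerStructure ρ (𝓕.relaxedAt N₀)).selmerGroup = ⊥)
    (hε₀ : ε₀ ∈ volOn (Option ↥N₀) (Wsub p 𝓕 N₀)) (hε₀0 : ε₀ ≠ 0)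
    {n : Finset (HeightOneSpectrum (𝓞 K))} (hn : D.IsLevel n)
    (hHn : Nat.card (D.atLevel 𝓕 n).selmerGroup = p) :
    kappa p 𝓕 D N₀ ε₀ n ≠ 0 := by
  have hfin : Finite 𝓕.selmerGroup := inferInstance
  have hSQ := hSQ_of p hU hH1
  have hW₀ := natCard_selmerGroup_relaxedAt_eq_pow_mul hperf hsum hcompl hM hS h𝓕 hfin hfind hχ hPS hU hH1 hN₀
  rw [hcore₀, AddSubgroup.card_bot, mul_one] at hW₀
  set N := n ∪ N₀ with hNdef
  have hN : D.IsLevel N := isLevel_union hn hN₀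
  have hW := natCard_relaxedAt_union p hperf hsum hcompl hM hS h𝓕 hfin hfind hχ hPS hU hH1 hN₀ hcore₀ hn
  have hvol := vol_mem_volOn_and_contract_vol p h𝓕 hfin hPS hSQ hε₀ hW₀ Finset.subset_union_right hN hW
  have hvol0 := vol_ne_zero p h𝓕 hfin hPS hSQ hε₀ hε₀0 hW₀ Finset.subset_union_right hN hW
  rw [kappa_of_isLevel p hn]
  -- the sign `(−1)^{#n}` is harmless
  suffices h : ((cross (Wsub p 𝓕 N) (vol p 𝓕 N₀ ε₀ N) (phiFamily p D n N) : Wsub p 𝓕 N) :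
      galoisCohomology ρ 1) ≠ 0 by
    rcases neg_one_pow_eq_or ℤ n.card with h1 | h1
    · rwa [h1, one_smul]
    · rwa [h1, neg_smul, one_smul, neg_ne_zero]
  rw [Ne, ZeroMemClass.coe_eq_zero]
  -- the stalk `H¹_{𝓕(n)}` as an `𝔽_p`-line inside `W(N)`
  let H : Submodule (ZMod p) (galoisCohomology ρ 1) := AddSubgroup.toZModSubmodule p (D.atLevel 𝓕 n).selmerGroup
  haveI : Finite H := finite_selmerGroup_atLevel D 𝓕 hfin n
  have hHfin : Module.finrank (ZMod p) H = 1 := by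
    have h := FiniteField.pow_finrank_eq_natCard p H
    rw [show Nat.card H = Nat.card (D.atLevel 𝓕 n).selmerGroup from rfl, hHn] at h
    have h1 : p ^ Module.finrank (ZMod p) H = p ^ 1 := by rw [h, pow_one]
    exact Nat.pow_right_injective (Fact.out : p.Prime).two_le h1
  have hHW : H ≤ Wsub p 𝓕 N := fun x hx =>
    (mem_Wsub_iff p 𝓕 N x).mpr (selmerGroup_mono (atLevel_le_relaxedAt 𝓕 D Finset.subset_union_left) hx)
  -- the slot functionals are independent on `W(N)`
  have hli : LinearIndependent (ZMod p) fun ℓ : ↥N => (Wsub p 𝓕 N).dualRestrict (phiFamily p D n N ℓ) := by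
    refine linearIndependent_domRestrict_of_finrank_add (W := H) (phiFamily p D n N) hHW ?_ ?_ ?_
    · intro ℓ w hw
      have hw' := (mem_selmerGroup_atLevel_iff_fFun_tFun p h𝓕 hPS hSQ hc hadm Finset.subset_union_left hN
        (hHW hw)).mp hw
      by_cases hℓ : ℓ.1 ∈ n
      · rw [phiFamily_apply_of_mem p hℓ]; exact hw'.1 ℓ.1 hℓ
      · rw [phiFamily_apply_of_not_mem p hℓ]; exact hw'.2 ℓ.1 ℓ.2 hℓ
    · intro v hv h
      refine (mem_selmerGroup_atLevel_iff_fFun_tFun p h𝓕 hPS hSQ hc hadm Finset.subset_union_left hN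
        hv).mpr ⟨fun q hq => ?_, fun q hq hqn => ?_⟩
      · have := h ⟨q, Finset.mem_union_left _ hq⟩
        rwa [phiFamily_apply_of_mem p (show (⟨q, _⟩ : ↥N).1 ∈ n from hq)] at this
      · have := h ⟨q, hq⟩
        rwa [phiFamily_apply_of_not_mem p (show (⟨q, hq⟩ : ↥N).1 ∉ n from hqn)] at this
    · rw [hHfin, finrank_Wsub p 𝓕 hW, Fintype.card_coe, add_comm]
  exact cross_ne_zero hvol.1 hvol0 (card_option_eq_finrank_Wsub p 𝓕 hW) hli

end Main

/-! ## §6. The existence half of the structure theorem at `m = 1` (instance-free statement) -/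

section End

variable {S : Finset (Place K)} {inv : LocalInvariants K p} {𝓕 : SelmerStructure ρ} {D : KolyvaginDatum ρ}

omit [Module (ZMod p) (galoisCohomology ρ 1)] in
/-- **K4 — a Kolyvagin system non-zero at every core vertex exists** (Mazur–Rubin JTNB 28 (2016)
Thm. 8.4 / Rubin PCMI Thm. 2.8.8–Cor. 2.8.9 (2), the surjectivity half, at `m = 1`).  Setting: p11's
R1-16 binders (`K` a number field, `p` prime, `M = T̄` killed by `p`, a Poitou–Tate family `inv`,
`𝓕` unramified outside `S` with finite Selmer and dual Selmer groups and CORE RANK ONE, a Kolyvagin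
datum with `𝒫 ∩ S = ∅`, admissible comparison maps, `#H¹_ur(K_𝔮, M) = p`, `#H¹(K_𝔮, M) = p²`,
`H¹_ur ⊔ H¹_tr = ⊤`, `H¹_ur ⊓ H¹_tr = ⊥` at the Kolyvagin primes), the one-class dual prime choice
`hprime'`, and `#H¹_{𝓕(n)}(K, M) = p` at the core vertices (p11's G1.2).  CONCLUSION: there is
`κ ∈ KS₁(M, 𝓕, 𝒫)` with `κ_n ≠ 0` for every level `n` with `H¹_{𝓕(n)^*}(K, M^D) = 0`. [folklore] -/
theorem exists_isKolyvaginSystem_ne_zero_of_core (hperf : inv.IsPerfect) (hsum : inv.SumLocalTermEqZero)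
    (hcompl : inv.SelmerComplement) (hM : ∀ m : M, p • m = 0)
    (hS : ∀ v : HeightOneSpectrum (𝓞 K), (Sum.inr v : Place K) ∉ S →
      ((p : ℕ) : 𝓞 K) ∉ v.asIdeal ∧ GaloisRep.IsUnramifiedAt v ρ)
    (h𝓕 : 𝓕.IsUnramifiedOutside S) (hfin : Finite 𝓕.selmerGroup)
    (hfind : Finite (inv.dualSelmerStructure ρ 𝓕).selmerGroup)
    (hχ : LocalInvariants.HasCoreRank inv 𝓕 p 1)
    (hPS : ∀ q ∈ D.primes, (Sum.inr q : Place K) ∉ S) (hadm : D.IsAdmissible)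
    (hU : ∀ q ∈ D.primes, Nat.card (unramifiedSubgroup (GaloisRep.toLocal q ρ) 1) = p)
    (hUT : ∀ q ∈ D.primes,
      unramifiedSubgroup (GaloisRep.toLocal q ρ) 1 ⊔ D.transverse (Sum.inr q) = ⊤)
    (hUT' : ∀ q ∈ D.primes, unramifiedSubgroup (GaloisRep.toLocal q ρ) 1 ⊓ D.transverse (Sum.inr q) = ⊥)
    (hH1 : ∀ q ∈ D.primes, Nat.card (galoisCohomology (GaloisRep.toLocal q ρ) 1) = p ^ 2)
    (hprime' : ∀ y : galoisCohomology (ρ.tateDual p) 1, y ≠ 0 →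
      {q ∈ D.primes | galoisCohomology.localization (ρ.tateDual p) (Sum.inr q) 1 y ≠ 0}.Infinite)
    (hHcore : ∀ n, D.IsLevel n → (inv.dualSelmerStructure ρ (D.atLevel 𝓕 n)).selmerGroup = ⊥ →
      Nat.card (D.atLevel 𝓕 n).selmerGroup = p) :
    ∃ κ : Finset (HeightOneSpectrum (𝓞 K)) → galoisCohomology ρ 1, D.IsKolyvaginSystem 𝓕 κ ∧
      ∀ n, D.IsLevel n → (inv.dualSelmerStructure ρ (D.atLevel 𝓕 n)).selmerGroup = ⊥ → κ n ≠ 0 := by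
  letI : Module (ZMod p) (galoisCohomology ρ 1) :=
    AddCommGroup.zmodModule (galoisCohomology.nsmul_eq_zero_of_forall ρ hM)
  haveI := hfin
  obtain ⟨N₀, ε₀, hN₀, hcore₀, hε₀, hε₀0⟩ :=
    exists_base p hperf hsum hcompl hM hS h𝓕 hfin hfind hχ hPS hU hH1 hprime'
  have hc := isCompl_of hUT hUT'
  exact ⟨kappa p 𝓕 D N₀ ε₀,
    isKolyvaginSystem_kappa p hperf hsum hcompl hM hS h𝓕 hfind hχ hPS hadm hU hc hH1 hN₀ hcore₀ hε₀,
    fun n hn hcore => kappa_ne_zero_of_natCard_eq p hperf hsum hcompl hM hS h𝓕 hfind hχ hPS hadm hU hc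
      hH1 hN₀ hcore₀ hε₀ hε₀0 hn (hHcore n hn hcore)⟩

end End

end Summit.BirchSwinnertonDyer.Rank1Residual.GaloisImage.CoreRankOne.Stalk

end
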